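import Summits.AtomisticToContinuum.BoseEinsteinCondensation.Theses.BECSwapNoCatastrophe
import Summits.AtomisticToContinuum.BoseEinsteinCondensation.Theorems.BECSwapNoCatastropheTorusHalfSwapOverlapSplit
import Summits.AtomisticToContinuum.BoseEinsteinCondensation.Theorems.BECSwapNoCatastropheAbsTorusDefs
import Literature.MathematicalPhysics.QuantumManyBody.PeriodicWeightedMaxFormGroundStates
import Literature.MathematicalPhysics.QuantumManyBody.HalfSwapTwoCopyForm
import Literature.MathematicalPhysics.QuantumManyBody.BoseGasHardCrossingLines
import Summits.AtomisticToContinuum.BoseEinsteinCondensation.Theorems.BECSwapNoCatastropheTorusHalfSwapOverlapAbsHardLayerPBasics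
import Summits.AtomisticToContinuum.BoseEinsteinCondensation.Theorems.BECSwapNoCatastropheTorusHalfSwapOverlapTwoCopyTransport
import Summits.AtomisticToContinuum.BoseEinsteinCondensation.Theorems.BECSwapNoCatastropheTorusHalfSwapOverlapAbsTransportDict
import Summits.AtomisticToContinuum.BoseEinsteinCondensation.Theorems.BECSwapNoCatastropheTorusHalfSwapOverlapScalarRellich
import Summits.AtomisticToContinuum.BoseEinsteinCondensation.Theorems.BECSwapNoCatastropheTorusHalfSwapOverlapAbsLimitProfile
import Summits.AtomisticToContinuum.BoseEinsteinCondensation.Theorems.BECSwapNoCatastropheTorusHalfSwapOverlapAbsMaxFormBoundL1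

/-!
# Skeleton v7 for crux `TorusHalfSwapOverlap` (stmt-AtomisticToContinuum-14393) — line `registered`, lead c7:
# the TRUNCATION SPLIT with its fixed-`n` half (S) decomposed into worker-sized stubs

Route `BECSwapNoCatastrophe` (sub-problem `BoseEinsteinCondensation`), crux rank 2 (the half-swapped torus
ground state remembers the product, `|⟨Θ, Ψ ⊗ Ψ⟩|² ≥ ½ + η`). Lead c7 picked the only payload line
(`registered` = `Lines/birth.lean` v6.8, whose three remaining stubs are the crux's open-problem content) and
RESHAPED it to the strategist's truncation split (`Lines/truncation_split.lean`; composition glue LANDED as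
`Split.TorusHalfSwapOverlap_of_subs_folded`, p170474):

  crux ⟸ U `stub_uniformTruncatedChord` ∧ S `stub_halfSwapTruncationStability`.

* **U (XL, the load; NOT worked by this lead):** the midpoint chord for the bounded truncations `v ⊓ m`, constants
  uniform in `m` — the thermodynamic-limit content of the crux, moved to the bounded class (for bounded `v`
  it is the `(½, 0)` chord of rank 3 `TorusSwapPathRigidity` = stmt-AtomisticToContinuum-14394).
* **S (fixed `n`, functional analysis; PROVED HERE modulo five registered stubs):** two-copy Simon monotone
  convergence on the absolute class, `inf_{Adm0} E2(½)_v ≤ inf_{Adm0} E2(½)_(v ⊓ m) + ε` eventually in `m`.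
  S is "bottom of the minimal form = bottom of the maximal form" for the half-swapped weight; the one-copy
  chain of the tree (`exists_limitProfile`, `maxFormBound_of_isRepulsiveFiniteRange`) is hard-wired to the
  Bose-symmetric core and to ONE profile for all pairs, so it is re-run SYMMETRY-FREE for PAIR-DEPENDENT profiles
  over the vocabulary `AbsTorus.*` (Theorems/BECSwapNoCatastropheAbsTorusDefs.lean, p172304):
  - `stub_twoCopyTransport` (T, M): the two-copy `Adm0` infimum of `E2(½)_w` IS the absolute ground-state energy of
    `(n+1)+(n+1)` particles with the transported weight, and that weight is the pair-profile interaction of the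
    profile matrix `halfSwapProfile w n` (`Fin.append` / `splitConfig` bookkeeping, `AppendEmbedding`);
  - `stub_absTransportDict` (D, M): the dictionary `Ψ ↦ η_Ψ = L^{3N/2}(Ψ ∘ fromUnitTorusN)` for plain `C¹`
    periodic `Ψ` (cell norm, `maxFormKin = ∫|∇Ψ|²`, `maxFormPotW = ∫ W|Ψ|²`; symmetric-free `PeriodicConfigFourier`);
  - `stub_scalarRellich` (R, M): bounded sequences in `L²((ℝ/ℤ)^{3N})` with bounded spectral kinetic energy have
    convergent subsequences (`Lattice.rellich` + Parseval);
  - `stub_absLimitProfile` (C, L; consumes R): compactness half of Simon's theorem on the absolute class — for a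
    measurable monotone tower `W_m ↑ W` with `sup_m E₀ᴬ(W_m) < ⊤` a unit `η ∈ L²` with `maxFormW W L η ≤ sup_m E₀ᴬ(W_m)`
    (near-minimisers, Rellich, lower semicontinuity, Fatou, Beppo Levi; template `exists_limitProfile_family`);
  - `stub_absMaxFormBoundL1` (B, L): Simon's `L¹` theorem on the absolute class — for `W' ∈ L¹` of the cell,
    `E₀ᴬ(W') ‖η‖² ≤ maxFormW W' L η` for every `η ∈ L²` (trigonometric polynomials realised as plain `C¹` periodic
    functions; template `periodicGroundStateEnergyW_mul_le_maxFormW` minus the symmetrisation);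
  - `stub_absMaxFormBoundPair` (H, XL, LEAD; consumes B): the maximal-form bound on the absolute class for a
    pair-PROFILE interaction with hard cores / non-integrable singularities — cut-off at the hard layer of the
    pairs that have hard radii (`hardLayerP`), hard-layer decay `o(s²)` by ACL + transversal crossings + Hardy on
    lines, softening (`softProfile`), then B (templates `BoseGasHardLayer*`, `BoseGasHardCrossingLines`,
    `BoseGasCutoffProduct`, `PeriodicMaxFormBoundHardCore(Step)` with `hardRad v ↦ hardRad (V i j)`).
  Composition `halfSwapTruncationStability_of hT hD hR hC hB hH : Goal.stub_halfSwapTruncationStability` is sorry-free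
  below (monotone tower of transported truncated weights, finiteness, limit profile, maximal-form bound at the
  profile, `E₀ᴬ(W_m) ↑ sup`), and `TorusHalfSwapOverlap_of hU hT hD hR hC hB hH` concludes the route decl BY NAME through
  the landed split glue.
-/

noncomputable section

namespace Summit.AtomisticToContinuum.BoseEinsteinCondensation.Cruxes.TorusHalfSwapOverlap.TruncationSplit

open MeasureTheory Filter Topology
open scoped ENNReal NNReal InnerProductSpace
open Literature.MathematicalPhysics.QuantumManyBody.BoseGas
open Summit.AtomisticToContinuum.BoseEinsteinCondensation.TwoCopyTorus
open Summit.AtomisticToContinuum.BoseEinsteinCondensation.AbsTorus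
open Summit.AtomisticToContinuum.BoseEinsteinCondensation.Cruxes.StaticResponseBound.UvThomsonForceWave
  (monotone_periodizedPotential_truncPotential iSup_periodizedPotential_truncPotential
    monotone_periodicInteraction_truncPotential iSup_periodicInteraction_truncPotential)

-- The measure on `ℝ/ℤ` is the Haar PROBABILITY measure, as in `PeriodicFormDomain.lean` (so that
-- `Lp ℂ 2 (volume : Measure (UnitAddTorus (Fin N × Fin 3)))` is the space on which `maxFormKin` / `maxFormW` live).
attribute [local instance] formDomain_measureSpace formDomain_isProbabilityMeasure formDomain_isProbabilityMeasure_pi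

/-! ## Registered obligations (`Goal.stub_x` = the statement of `stub_x`, reducibly) -/

namespace Goal

/-- Registered statement of `stub_uniformTruncatedChord` (U, XL — the load): the uniform truncated chord. -/
abbrev stub_uniformTruncatedChord : Prop :=
    ∀ v : ℝ → ℝ≥0∞, IsRepulsiveFiniteRange v → ∃ ρ₀ : ℝ, 0 < ρ₀ ∧ ∀ ρ : ℝ, 0 < ρ → ρ < ρ₀ →
      ∃ η : ℝ, 0 < η ∧ ∀ᶠ n : ℕ in atTop, ∃ δ : ℝ≥0∞, 0 < δ ∧ ∀ᶠ m : ℕ in atTop,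
        ∀ Φ Θ : Config2 n → ℂ,
          Adm0 n (sideLength ρ (n + 1)) Φ →
          E2zero (truncPotential v m) n (sideLength ρ (n + 1)) Φ ≤
            (⨅ (Θ' : Config2 n → ℂ) (_ : Adm0 n (sideLength ρ (n + 1)) Θ'),
              E2zero (truncPotential v m) n (sideLength ρ (n + 1)) Θ') + δ →
          Adm0 n (sideLength ρ (n + 1)) Θ →
          E2half (truncPotential v m) n (sideLength ρ (n + 1)) Θ ≤
            (⨅ (Θ' : Config2 n → ℂ) (_ : Adm0 n (sideLength ρ (n + 1)) Θ'),
              E2half (truncPotential v m) n (sideLength ρ (n + 1)) Θ') + δ →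
          ENNReal.ofReal (1 / 2 + η) ≤
            (‖∫ Z in cell2 n (sideLength ρ (n + 1)), (starRingEnd ℂ) (Θ Z) * Φ Z‖₊ : ENNReal) ^ 2

/-- Statement of S `stub_halfSwapTruncationStability` (no longer a stub: PROVED below from T, R, C, B, H). -/
abbrev stub_halfSwapTruncationStability : Prop :=
    ∀ v : ℝ → ℝ≥0∞, IsRepulsiveFiniteRange v → ∀ (n : ℕ) (L : ℝ), 0 < L →
      (⨅ (Θ : Config2 n → ℂ) (_ : Adm0 n L Θ), E2half v n L Θ) ≠ ⊤ → ∀ ε : ℝ, 0 < ε →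
        ∃ m₀ : ℕ, ∀ m : ℕ, m₀ ≤ m → (⨅ (Θ : Config2 n → ℂ) (_ : Adm0 n L Θ), E2half v n L Θ) ≤
          (⨅ (Θ : Config2 n → ℂ) (_ : Adm0 n L Θ), E2half (truncPotential v m) n L Θ) + ENNReal.ofReal ε

/-- Registered statement of `stub_twoCopyTransport` (T, M): the two-copy absolute infimum of `E2(½)_w` is the
absolute ground-state energy of `(n+1)+(n+1)` particles for the transported weight, which is the pair-profile
interaction of `halfSwapProfile w n`. -/
abbrev stub_twoCopyTransport : Prop :=
    ∀ (w : ℝ → ℝ≥0∞) (n : ℕ) (L : ℝ), 0 < L →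
      (⨅ (Θ : Config2 n → ℂ) (_ : Adm0 n L Θ), E2half w n L Θ) =
          absGroundStateEnergyW
            (fun Z : Config ((n + 1) + (n + 1)) => halfSwapWeight w n L (splitConfig (n + 1) (n + 1) Z)) L ∧
        ∀ Z : Config ((n + 1) + (n + 1)),
          halfSwapWeight w n L (splitConfig (n + 1) (n + 1) Z) = pairInteraction (halfSwapProfile w n) L Z

/-- Registered statement of `stub_absTransportDict` (D, M): the transport dictionary for plain `C¹` periodic
functions — the scaled torus class `η_Ψ = L^{3N/2} (Ψ ∘ fromUnitTorusN L)` of `Ψ` has cell norm, spectral kinetic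
energy = `∫_cell |∇Ψ|²`, and maximal-form potential energy = `∫_cell W |Ψ|²`. -/
abbrev stub_absTransportDict : Prop :=
    ∀ (N : ℕ) (L : ℝ), 0 < L → ∀ Ψ : Config N → ℂ, ContDiff ℝ 1 Ψ → IsTorusPeriodic L Ψ →
      ∃ ηΨ : Lp ℂ 2 (volume : Measure (UnitAddTorus (Fin N × Fin 3))),
        (∀ᵐ t ∂(volume : Measure (UnitAddTorus (Fin N × Fin 3))),
          (ηΨ : UnitAddTorus (Fin N × Fin 3) → ℂ) t = (cellScale N L : ℂ) * Ψ (fromUnitTorusN L t)) ∧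
        ENNReal.ofReal (‖ηΨ‖ ^ 2) = ∫⁻ X in cellN N L, (‖Ψ X‖₊ : ℝ≥0∞) ^ 2 ∧
        maxFormKin L ηΨ = ∫⁻ X in cellN N L, kineticDensity Ψ X ∧
        ∀ W : Config N → ℝ≥0∞, Measurable W →
          maxFormPotW W L ηΨ = ∫⁻ X in cellN N L, W X * (‖Ψ X‖₊ : ℝ≥0∞) ^ 2

/-- Registered statement of `stub_scalarRellich` (R, M): Rellich on `L²((ℝ/ℤ)^{3N})` in sequence form — a
norm-bounded sequence with bounded spectral kinetic energy `maxFormKin` has a convergent subsequence. -/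
abbrev stub_scalarRellich : Prop :=
    ∀ (N : ℕ) (L : ℝ), 0 < L → ∀ K : ℝ≥0∞, K ≠ ⊤ →
      ∀ f : ℕ → Lp ℂ 2 (volume : Measure (UnitAddTorus (Fin N × Fin 3))),
        (∀ i, ‖f i‖ ≤ 1) → (∀ i, maxFormKin L (f i) ≤ K) →
        ∃ (η : Lp ℂ 2 (volume : Measure (UnitAddTorus (Fin N × Fin 3)))) (φ : ℕ → ℕ),
          StrictMono φ ∧ Tendsto (fun i => f (φ i)) atTop (𝓝 η)

/-- Registered statement of `stub_absLimitProfile` (C, L; Rellich as hypothesis): the compactness half of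
Simon's monotone convergence theorem on the absolute class. -/
abbrev stub_absLimitProfile : Prop :=
    (∀ (N : ℕ) (L : ℝ), 0 < L → ∀ Ψ : Config N → ℂ, ContDiff ℝ 1 Ψ → IsTorusPeriodic L Ψ →
      ∃ ηΨ : Lp ℂ 2 (volume : Measure (UnitAddTorus (Fin N × Fin 3))),
        (∀ᵐ t ∂(volume : Measure (UnitAddTorus (Fin N × Fin 3))),
          (ηΨ : UnitAddTorus (Fin N × Fin 3) → ℂ) t = (cellScale N L : ℂ) * Ψ (fromUnitTorusN L t)) ∧
        ENNReal.ofReal (‖ηΨ‖ ^ 2) = ∫⁻ X in cellN N L, (‖Ψ X‖₊ : ℝ≥0∞) ^ 2 ∧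
        maxFormKin L ηΨ = ∫⁻ X in cellN N L, kineticDensity Ψ X ∧
        ∀ W : Config N → ℝ≥0∞, Measurable W →
          maxFormPotW W L ηΨ = ∫⁻ X in cellN N L, W X * (‖Ψ X‖₊ : ℝ≥0∞) ^ 2) →
    (∀ (N : ℕ) (L : ℝ), 0 < L → ∀ K : ℝ≥0∞, K ≠ ⊤ →
      ∀ f : ℕ → Lp ℂ 2 (volume : Measure (UnitAddTorus (Fin N × Fin 3))),
        (∀ i, ‖f i‖ ≤ 1) → (∀ i, maxFormKin L (f i) ≤ K) →
        ∃ (η : Lp ℂ 2 (volume : Measure (UnitAddTorus (Fin N × Fin 3)))) (φ : ℕ → ℕ),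
          StrictMono φ ∧ Tendsto (fun i => f (φ i)) atTop (𝓝 η)) →
    ∀ (N : ℕ) (L : ℝ), 0 < L → ∀ (W : ℕ → Config N → ℝ≥0∞) (Winf : Config N → ℝ≥0∞),
      (∀ m, Measurable (W m)) → (∀ X, Monotone fun m => W m X) → (∀ X, ⨆ m, W m X = Winf X) →
      (⨆ m, absGroundStateEnergyW (W m) L) ≠ ⊤ →
      ∃ η : Lp ℂ 2 (volume : Measure (UnitAddTorus (Fin N × Fin 3))), ‖η‖ = 1 ∧
        maxFormW Winf L η ≤ ⨆ m, absGroundStateEnergyW (W m) L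

/-- Registered statement of `stub_absMaxFormBoundL1` (B, L): Simon's `L¹` maximal-form bound on the absolute
class. -/
abbrev stub_absMaxFormBoundL1 : Prop :=
    (∀ (N : ℕ) (L : ℝ), 0 < L → ∀ Ψ : Config N → ℂ, ContDiff ℝ 1 Ψ → IsTorusPeriodic L Ψ →
      ∃ ηΨ : Lp ℂ 2 (volume : Measure (UnitAddTorus (Fin N × Fin 3))),
        (∀ᵐ t ∂(volume : Measure (UnitAddTorus (Fin N × Fin 3))),
          (ηΨ : UnitAddTorus (Fin N × Fin 3) → ℂ) t = (cellScale N L : ℂ) * Ψ (fromUnitTorusN L t)) ∧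
        ENNReal.ofReal (‖ηΨ‖ ^ 2) = ∫⁻ X in cellN N L, (‖Ψ X‖₊ : ℝ≥0∞) ^ 2 ∧
        maxFormKin L ηΨ = ∫⁻ X in cellN N L, kineticDensity Ψ X ∧
        ∀ W : Config N → ℝ≥0∞, Measurable W →
          maxFormPotW W L ηΨ = ∫⁻ X in cellN N L, W X * (‖Ψ X‖₊ : ℝ≥0∞) ^ 2) →
    ∀ (N : ℕ) (L : ℝ), 0 < L → ∀ W' : Config N → ℝ≥0∞, Measurable W' → (∫⁻ X in cellN N L, W' X) ≠ ⊤ →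
      ∀ η : Lp ℂ 2 (volume : Measure (UnitAddTorus (Fin N × Fin 3))),
        absGroundStateEnergyW W' L * ENNReal.ofReal (‖η‖ ^ 2) ≤ maxFormW W' L η

/-- Registered statement of `stub_absMaxFormBoundPair` (H, XL, lead; the dictionary and the `L¹` bound as hypotheses): the
maximal-form bound on the absolute class for a symmetric matrix of repulsive finite-range pair profiles (hard
cores and non-integrable singularities allowed, pair by pair). -/
abbrev stub_absMaxFormBoundPair : Prop :=
    (∀ (N : ℕ) (L : ℝ), 0 < L → ∀ Ψ : Config N → ℂ, ContDiff ℝ 1 Ψ → IsTorusPeriodic L Ψ →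
      ∃ ηΨ : Lp ℂ 2 (volume : Measure (UnitAddTorus (Fin N × Fin 3))),
        (∀ᵐ t ∂(volume : Measure (UnitAddTorus (Fin N × Fin 3))),
          (ηΨ : UnitAddTorus (Fin N × Fin 3) → ℂ) t = (cellScale N L : ℂ) * Ψ (fromUnitTorusN L t)) ∧
        ENNReal.ofReal (‖ηΨ‖ ^ 2) = ∫⁻ X in cellN N L, (‖Ψ X‖₊ : ℝ≥0∞) ^ 2 ∧
        maxFormKin L ηΨ = ∫⁻ X in cellN N L, kineticDensity Ψ X ∧
        ∀ W : Config N → ℝ≥0∞, Measurable W →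
          maxFormPotW W L ηΨ = ∫⁻ X in cellN N L, W X * (‖Ψ X‖₊ : ℝ≥0∞) ^ 2) →
    ((∀ (N : ℕ) (L : ℝ), 0 < L → ∀ Ψ : Config N → ℂ, ContDiff ℝ 1 Ψ → IsTorusPeriodic L Ψ →
      ∃ ηΨ : Lp ℂ 2 (volume : Measure (UnitAddTorus (Fin N × Fin 3))),
        (∀ᵐ t ∂(volume : Measure (UnitAddTorus (Fin N × Fin 3))),
          (ηΨ : UnitAddTorus (Fin N × Fin 3) → ℂ) t = (cellScale N L : ℂ) * Ψ (fromUnitTorusN L t)) ∧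
        ENNReal.ofReal (‖ηΨ‖ ^ 2) = ∫⁻ X in cellN N L, (‖Ψ X‖₊ : ℝ≥0∞) ^ 2 ∧
        maxFormKin L ηΨ = ∫⁻ X in cellN N L, kineticDensity Ψ X ∧
        ∀ W : Config N → ℝ≥0∞, Measurable W →
          maxFormPotW W L ηΨ = ∫⁻ X in cellN N L, W X * (‖Ψ X‖₊ : ℝ≥0∞) ^ 2) →
    ∀ (N : ℕ) (L : ℝ), 0 < L → ∀ W' : Config N → ℝ≥0∞, Measurable W' → (∫⁻ X in cellN N L, W' X) ≠ ⊤ →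
      ∀ η : Lp ℂ 2 (volume : Measure (UnitAddTorus (Fin N × Fin 3))),
        absGroundStateEnergyW W' L * ENNReal.ofReal (‖η‖ ^ 2) ≤ maxFormW W' L η) →
    ∀ (N : ℕ) (L : ℝ), 0 < L → ∀ V : Fin N → Fin N → ℝ → ℝ≥0∞, (∀ i j, V i j = V j i) →
      (∀ i j, IsRepulsiveFiniteRange (V i j)) →
      ∀ η : Lp ℂ 2 (volume : Measure (UnitAddTorus (Fin N × Fin 3))),
        absGroundStateEnergyW (pairInteraction V L) L * ENNReal.ofReal (‖η‖ ^ 2) ≤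
          maxFormW (pairInteraction V L) L η

/-- Registered statement of `stub_hardLayerPVanishing` — X (L): a finite-energy function vanishes a.e. on the pair-profile hard configurations (twin of `ae_eq_zero_of_mem_hardLayer_zero`). -/
abbrev stub_hardLayerPVanishing : Prop :=
    ∀ (N : ℕ) (L : ℝ), 0 < L → ∀ V : Fin N → Fin N → ℝ → ℝ≥0∞, (∀ i j, V i j = V j i) →
      (∀ i j, Measurable (V i j)) →
      ∀ (η : UnitAddTorus (Fin N × Fin 3) → ℂ) (G H : Fin N × Fin 3 → UnitAddTorus (Fin N × Fin 3) → ℂ),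
        (∀ q, G q =ᵐ[volume] η) →
        (∀ q : Fin N × Fin 3, ∀ᵐ t ∂(volume : Measure (UnitAddTorus (Fin N × Fin 3))),
        (∀ a b : ℝ, IntervalIntegrable (fun x : ℝ => H q (t + Pi.single q ((x : ℝ) : UnitAddCircle))) volume a b ∧
          G q (t + Pi.single q ((b : ℝ) : UnitAddCircle)) - G q (t + Pi.single q ((a : ℝ) : UnitAddCircle)) =
            ∫ x in a..b, H q (t + Pi.single q ((x : ℝ) : UnitAddCircle))) ∧
        (∀ a b : ℝ, ∫⁻ x in Set.Ioo a b, pairInteraction V L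
          (fromUnitTorusN L (t + Pi.single q ((x : ℝ) : UnitAddCircle))) *
            ‖G q (t + Pi.single q ((x : ℝ) : UnitAddCircle))‖ₑ ^ 2 ≠ ⊤)) →
        ∀ᵐ t ∂(volume : Measure (UnitAddTorus (Fin N × Fin 3))), fromUnitTorusN L t ∈ hardLayerP V L 0 → η t = 0

/-- Registered statement of `stub_hardLayerPCutoff` — K (M): smooth periodic cut-offs vanishing near the pair-profile hard configurations (twin of `exists_hardLayer_cutoff`, no symmetrisation). -/
abbrev stub_hardLayerPCutoff : Prop :=
    ∀ (N : ℕ) (L : ℝ), 0 < L → ∀ V : Fin N → Fin N → ℝ → ℝ≥0∞,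
      ∃ C : ℝ, 0 ≤ C ∧ ∀ s : ℝ, 0 < s → s ≤ L →
        ∃ ξ : Config N → ℝ, ContDiff ℝ 1 ξ ∧ IsTorusPeriodic L ξ ∧ (∀ X, 0 ≤ ξ X ∧ ξ X ≤ 1) ∧
          (∀ X ∈ hardLayerP V L (s / 2), ξ X = 0) ∧
          (∀ X ∉ hardLayerP V L s, ∀ X' : Config N, (∀ i, ‖X' i - X i‖ < s / 10) → ξ X' = 1) ∧
          ∀ X, ‖fderiv ℝ ξ X‖ ≤ C / s

/-- Registered statement of `stub_pairStep` — S (L; dictionary D and cut-off K as hypotheses): the cut-off step for pair profiles (twin of `periodicGroundStateEnergy_mul_le_maxForm_step`). -/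
abbrev stub_pairStep : Prop :=
    (∀ (N : ℕ) (L : ℝ), 0 < L → ∀ Ψ : Config N → ℂ, ContDiff ℝ 1 Ψ → IsTorusPeriodic L Ψ →
      ∃ ηΨ : Lp ℂ 2 (volume : Measure (UnitAddTorus (Fin N × Fin 3))),
        (∀ᵐ t ∂(volume : Measure (UnitAddTorus (Fin N × Fin 3))),
          (ηΨ : UnitAddTorus (Fin N × Fin 3) → ℂ) t = (cellScale N L : ℂ) * Ψ (fromUnitTorusN L t)) ∧
        ENNReal.ofReal (‖ηΨ‖ ^ 2) = ∫⁻ X in cellN N L, (‖Ψ X‖₊ : ℝ≥0∞) ^ 2 ∧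
        maxFormKin L ηΨ = ∫⁻ X in cellN N L, kineticDensity Ψ X ∧
        ∀ W : Config N → ℝ≥0∞, Measurable W →
          maxFormPotW W L ηΨ = ∫⁻ X in cellN N L, W X * (‖Ψ X‖₊ : ℝ≥0∞) ^ 2) →
    (∀ (N : ℕ) (L : ℝ), 0 < L → ∀ V : Fin N → Fin N → ℝ → ℝ≥0∞,
      ∃ C : ℝ, 0 ≤ C ∧ ∀ s : ℝ, 0 < s → s ≤ L →
        ∃ ξ : Config N → ℝ, ContDiff ℝ 1 ξ ∧ IsTorusPeriodic L ξ ∧ (∀ X, 0 ≤ ξ X ∧ ξ X ≤ 1) ∧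
          (∀ X ∈ hardLayerP V L (s / 2), ξ X = 0) ∧
          (∀ X ∉ hardLayerP V L s, ∀ X' : Config N, (∀ i, ‖X' i - X i‖ < s / 10) → ξ X' = 1) ∧
          ∀ X, ‖fderiv ℝ ξ X‖ ≤ C / s) →
    ∀ (N : ℕ) (L : ℝ), 0 < L → ∀ V : Fin N → Fin N → ℝ → ℝ≥0∞, (∀ i j, V i j = V j i) →
      (∀ i j, IsRepulsiveFiniteRange (V i j)) →
      ∀ (ζ : Lp ℂ 2 (volume : Measure (UnitAddTorus (Fin N × Fin 3)))) (k : ℝ),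
        (∀ᵐ t ∂(volume : Measure (UnitAddTorus (Fin N × Fin 3))), ‖(ζ : UnitAddTorus (Fin N × Fin 3) → ℂ) t‖ ≤ k) →
        (∀ ε' : ℝ, 0 < ε' → ∃ s₀ : ℝ, 0 < s₀ ∧ ∀ s : ℝ, 0 < s → s ≤ s₀ →
          ∫⁻ t in fromUnitTorusN L ⁻¹' hardLayerP V L s,
            ((‖(ζ : UnitAddTorus (Fin N × Fin 3) → ℂ) t‖₊ : ℝ≥0∞)) ^ 2 ≤ ENNReal.ofReal (ε' * s ^ 2)) →
        ∀ ε : ℝ, 0 < ε →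
          absGroundStateEnergyW (pairInteraction V L) L * ENNReal.ofReal (‖ζ‖ ^ 2 - ε) ≤
            ENNReal.ofReal (1 + ε) * maxFormW (pairInteraction V L) L ζ + ENNReal.ofReal ε

/-- Registered statement of `stub_hardLayerPHardy` — Y (L): the integrated Hardy layer bound for pair profiles (twin of `setLIntegral_layerA_le`). -/
abbrev stub_hardLayerPHardy : Prop :=
    ∀ (N : ℕ) (L : ℝ), 0 < L → ∀ V : Fin N → Fin N → ℝ → ℝ≥0∞, (∀ i j, V i j = V j i) →
      (∀ i j, Measurable (V i j)) →
      ∀ (η : UnitAddTorus (Fin N × Fin 3) → ℂ) (G H : Fin N × Fin 3 → UnitAddTorus (Fin N × Fin 3) → ℂ),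
        (∀ q, G q =ᵐ[volume] η) → (∀ q, Measurable (H q)) →
        (∀ q : Fin N × Fin 3, ∀ᵐ t ∂(volume : Measure (UnitAddTorus (Fin N × Fin 3))),
        (∀ a b : ℝ, IntervalIntegrable (fun x : ℝ => H q (t + Pi.single q ((x : ℝ) : UnitAddCircle))) volume a b ∧
          G q (t + Pi.single q ((b : ℝ) : UnitAddCircle)) - G q (t + Pi.single q ((a : ℝ) : UnitAddCircle)) =
            ∫ x in a..b, H q (t + Pi.single q ((x : ℝ) : UnitAddCircle))) ∧
        (∀ a b : ℝ, ∫⁻ x in Set.Ioo a b, pairInteraction V L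
          (fromUnitTorusN L (t + Pi.single q ((x : ℝ) : UnitAddCircle))) *
            ‖G q (t + Pi.single q ((x : ℝ) : UnitAddCircle))‖ₑ ^ 2 ≠ ⊤)) →
        ∀ s : ℝ, 0 < s →
          ∫⁻ t in {t : UnitAddTorus (Fin N × Fin 3) | ∃ (i j : Fin N) (n : Fin 3 → ℤ), i ≠ j ∧
              (hardRad (V i j)).Nonempty ∧
              0 < Metric.infDist (pairRad L (fromUnitTorusN L t) i j n) (hardRad (V i j)) ∧
              Metric.infDist (pairRad L (fromUnitTorusN L t) i j n) (hardRad (V i j)) ≤ 3 * s ∧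
              40 * s ≤ pairRad L (fromUnitTorusN L t) i j n},
            ‖η t‖ₑ ^ 2 ≤
            ENNReal.ofReal (11 * s / L) * ENNReal.ofReal (22 * s / L) *
              ∑ q : Fin N × Fin 3, ∫⁻ t, (hardZoneP V L s).indicator (1 : Config N → ℝ≥0∞) (fromUnitTorusN L t) *
                ‖H q t‖ₑ ^ 2

/-- Registered statement of `stub_hardLayerPDecay` — Z (L; Y and X as hypotheses): the mass in the pair-profile hard layers is `o(s²)` (twin of `exists_setLIntegral_hardLayer_le`). -/
abbrev stub_hardLayerPDecay : Prop :=
    (∀ (N : ℕ) (L : ℝ), 0 < L → ∀ V : Fin N → Fin N → ℝ → ℝ≥0∞, (∀ i j, V i j = V j i) →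
      (∀ i j, Measurable (V i j)) →
      ∀ (η : UnitAddTorus (Fin N × Fin 3) → ℂ) (G H : Fin N × Fin 3 → UnitAddTorus (Fin N × Fin 3) → ℂ),
        (∀ q, G q =ᵐ[volume] η) → (∀ q, Measurable (H q)) →
        (∀ q : Fin N × Fin 3, ∀ᵐ t ∂(volume : Measure (UnitAddTorus (Fin N × Fin 3))),
        (∀ a b : ℝ, IntervalIntegrable (fun x : ℝ => H q (t + Pi.single q ((x : ℝ) : UnitAddCircle))) volume a b ∧
          G q (t + Pi.single q ((b : ℝ) : UnitAddCircle)) - G q (t + Pi.single q ((a : ℝ) : UnitAddCircle)) =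
            ∫ x in a..b, H q (t + Pi.single q ((x : ℝ) : UnitAddCircle))) ∧
        (∀ a b : ℝ, ∫⁻ x in Set.Ioo a b, pairInteraction V L
          (fromUnitTorusN L (t + Pi.single q ((x : ℝ) : UnitAddCircle))) *
            ‖G q (t + Pi.single q ((x : ℝ) : UnitAddCircle))‖ₑ ^ 2 ≠ ⊤)) →
        ∀ s : ℝ, 0 < s →
          ∫⁻ t in {t : UnitAddTorus (Fin N × Fin 3) | ∃ (i j : Fin N) (n : Fin 3 → ℤ), i ≠ j ∧
              (hardRad (V i j)).Nonempty ∧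
              0 < Metric.infDist (pairRad L (fromUnitTorusN L t) i j n) (hardRad (V i j)) ∧
              Metric.infDist (pairRad L (fromUnitTorusN L t) i j n) (hardRad (V i j)) ≤ 3 * s ∧
              40 * s ≤ pairRad L (fromUnitTorusN L t) i j n},
            ‖η t‖ₑ ^ 2 ≤
            ENNReal.ofReal (11 * s / L) * ENNReal.ofReal (22 * s / L) *
              ∑ q : Fin N × Fin 3, ∫⁻ t, (hardZoneP V L s).indicator (1 : Config N → ℝ≥0∞) (fromUnitTorusN L t) *
                ‖H q t‖ₑ ^ 2) →
    (∀ (N : ℕ) (L : ℝ), 0 < L → ∀ V : Fin N → Fin N → ℝ → ℝ≥0∞, (∀ i j, V i j = V j i) →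
      (∀ i j, Measurable (V i j)) →
      ∀ (η : UnitAddTorus (Fin N × Fin 3) → ℂ) (G H : Fin N × Fin 3 → UnitAddTorus (Fin N × Fin 3) → ℂ),
        (∀ q, G q =ᵐ[volume] η) →
        (∀ q : Fin N × Fin 3, ∀ᵐ t ∂(volume : Measure (UnitAddTorus (Fin N × Fin 3))),
        (∀ a b : ℝ, IntervalIntegrable (fun x : ℝ => H q (t + Pi.single q ((x : ℝ) : UnitAddCircle))) volume a b ∧
          G q (t + Pi.single q ((b : ℝ) : UnitAddCircle)) - G q (t + Pi.single q ((a : ℝ) : UnitAddCircle)) =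
            ∫ x in a..b, H q (t + Pi.single q ((x : ℝ) : UnitAddCircle))) ∧
        (∀ a b : ℝ, ∫⁻ x in Set.Ioo a b, pairInteraction V L
          (fromUnitTorusN L (t + Pi.single q ((x : ℝ) : UnitAddCircle))) *
            ‖G q (t + Pi.single q ((x : ℝ) : UnitAddCircle))‖ₑ ^ 2 ≠ ⊤)) →
        ∀ᵐ t ∂(volume : Measure (UnitAddTorus (Fin N × Fin 3))), fromUnitTorusN L t ∈ hardLayerP V L 0 → η t = 0) →
    ∀ (N : ℕ) (L : ℝ), 0 < L → ∀ V : Fin N → Fin N → ℝ → ℝ≥0∞, (∀ i j, V i j = V j i) →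
      (∀ i j, Measurable (V i j)) → ∀ R₀ : ℝ, (∀ i j, ∀ b ∈ hardRad (V i j), b ≤ R₀) →
      ∀ (η : UnitAddTorus (Fin N × Fin 3) → ℂ) (G H : Fin N × Fin 3 → UnitAddTorus (Fin N × Fin 3) → ℂ),
        (∀ q, G q =ᵐ[volume] η) → (∀ q, Measurable (H q)) → (∀ q, ∫⁻ t, ‖H q t‖ₑ ^ 2 ≠ ⊤) →
        (∀ q : Fin N × Fin 3, ∀ᵐ t ∂(volume : Measure (UnitAddTorus (Fin N × Fin 3))),
        (∀ a b : ℝ, IntervalIntegrable (fun x : ℝ => H q (t + Pi.single q ((x : ℝ) : UnitAddCircle))) volume a b ∧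
          G q (t + Pi.single q ((b : ℝ) : UnitAddCircle)) - G q (t + Pi.single q ((a : ℝ) : UnitAddCircle)) =
            ∫ x in a..b, H q (t + Pi.single q ((x : ℝ) : UnitAddCircle))) ∧
        (∀ a b : ℝ, ∫⁻ x in Set.Ioo a b, pairInteraction V L
          (fromUnitTorusN L (t + Pi.single q ((x : ℝ) : UnitAddCircle))) *
            ‖G q (t + Pi.single q ((x : ℝ) : UnitAddCircle))‖ₑ ^ 2 ≠ ⊤)) →
        ∀ k : ℝ, (∀ᵐ t ∂(volume : Measure (UnitAddTorus (Fin N × Fin 3))), ‖η t‖ ≤ k) →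
        ∀ ε : ℝ, 0 < ε → ∃ s₀ : ℝ, 0 < s₀ ∧ ∀ s : ℝ, 0 < s → s ≤ s₀ →
          ∫⁻ t in fromUnitTorusN L ⁻¹' hardLayerP V L s, ‖η t‖ₑ ^ 2 ≤ ENNReal.ofReal (ε * s ^ 2)

/-- Registered statement of `stub_pairFinal` — F (L; Z and S as hypotheses): clamping + ACL representatives + the `ε → 0` step (twin of `PeriodicMaxFormBoundHardCore.lean`). -/
abbrev stub_pairFinal : Prop :=
    (∀ (N : ℕ) (L : ℝ), 0 < L → ∀ V : Fin N → Fin N → ℝ → ℝ≥0∞, (∀ i j, V i j = V j i) →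
      (∀ i j, Measurable (V i j)) → ∀ R₀ : ℝ, (∀ i j, ∀ b ∈ hardRad (V i j), b ≤ R₀) →
      ∀ (η : UnitAddTorus (Fin N × Fin 3) → ℂ) (G H : Fin N × Fin 3 → UnitAddTorus (Fin N × Fin 3) → ℂ),
        (∀ q, G q =ᵐ[volume] η) → (∀ q, Measurable (H q)) → (∀ q, ∫⁻ t, ‖H q t‖ₑ ^ 2 ≠ ⊤) →
        (∀ q : Fin N × Fin 3, ∀ᵐ t ∂(volume : Measure (UnitAddTorus (Fin N × Fin 3))),
        (∀ a b : ℝ, IntervalIntegrable (fun x : ℝ => H q (t + Pi.single q ((x : ℝ) : UnitAddCircle))) volume a b ∧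
          G q (t + Pi.single q ((b : ℝ) : UnitAddCircle)) - G q (t + Pi.single q ((a : ℝ) : UnitAddCircle)) =
            ∫ x in a..b, H q (t + Pi.single q ((x : ℝ) : UnitAddCircle))) ∧
        (∀ a b : ℝ, ∫⁻ x in Set.Ioo a b, pairInteraction V L
          (fromUnitTorusN L (t + Pi.single q ((x : ℝ) : UnitAddCircle))) *
            ‖G q (t + Pi.single q ((x : ℝ) : UnitAddCircle))‖ₑ ^ 2 ≠ ⊤)) →
        ∀ k : ℝ, (∀ᵐ t ∂(volume : Measure (UnitAddTorus (Fin N × Fin 3))), ‖η t‖ ≤ k) →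
        ∀ ε : ℝ, 0 < ε → ∃ s₀ : ℝ, 0 < s₀ ∧ ∀ s : ℝ, 0 < s → s ≤ s₀ →
          ∫⁻ t in fromUnitTorusN L ⁻¹' hardLayerP V L s, ‖η t‖ₑ ^ 2 ≤ ENNReal.ofReal (ε * s ^ 2)) →
    (∀ (N : ℕ) (L : ℝ), 0 < L → ∀ V : Fin N → Fin N → ℝ → ℝ≥0∞, (∀ i j, V i j = V j i) →
      (∀ i j, IsRepulsiveFiniteRange (V i j)) →
      ∀ (ζ : Lp ℂ 2 (volume : Measure (UnitAddTorus (Fin N × Fin 3)))) (k : ℝ),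
        (∀ᵐ t ∂(volume : Measure (UnitAddTorus (Fin N × Fin 3))), ‖(ζ : UnitAddTorus (Fin N × Fin 3) → ℂ) t‖ ≤ k) →
        (∀ ε' : ℝ, 0 < ε' → ∃ s₀ : ℝ, 0 < s₀ ∧ ∀ s : ℝ, 0 < s → s ≤ s₀ →
          ∫⁻ t in fromUnitTorusN L ⁻¹' hardLayerP V L s,
            ((‖(ζ : UnitAddTorus (Fin N × Fin 3) → ℂ) t‖₊ : ℝ≥0∞)) ^ 2 ≤ ENNReal.ofReal (ε' * s ^ 2)) →
        ∀ ε : ℝ, 0 < ε →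
          absGroundStateEnergyW (pairInteraction V L) L * ENNReal.ofReal (‖ζ‖ ^ 2 - ε) ≤
            ENNReal.ofReal (1 + ε) * maxFormW (pairInteraction V L) L ζ + ENNReal.ofReal ε) →
    ∀ (N : ℕ) (L : ℝ), 0 < L → ∀ V : Fin N → Fin N → ℝ → ℝ≥0∞, (∀ i j, V i j = V j i) →
      (∀ i j, IsRepulsiveFiniteRange (V i j)) →
      ∀ η : Lp ℂ 2 (volume : Measure (UnitAddTorus (Fin N × Fin 3))),
        absGroundStateEnergyW (pairInteraction V L) L * ENNReal.ofReal (‖η‖ ^ 2) ≤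
          maxFormW (pairInteraction V L) L η

end Goal

/-! ## The stubs (sorried here; each lands in its own `Theorems/BECSwapNoCatastropheTorusHalfSwapOverlap…` file)

LANDED (imported above, same namespace, so not re-declared here): `stub_twoCopyTransport` (p173404),
`stub_absTransportDict` (p173214), `stub_scalarRellich` (p173223), `stub_absLimitProfile` (p173286),
`stub_absMaxFormBoundL1` (p173393). OPEN: `stub_uniformTruncatedChord` (U); H `stub_absMaxFormBoundPair` is COMPOSED below (`absMaxFormBoundPair_of`) from the six
registered sub-stubs X `stub_hardLayerPVanishing`, K `stub_hardLayerPCutoff`, S `stub_pairStep`, Y `stub_hardLayerPHardy`,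
Z `stub_hardLayerPDecay`, F `stub_pairFinal` (pair-profile twins of the one-copy hard-core chain). -/

/-- **Stub U (XL, the load): the uniform truncated chord.** -/
theorem stub_uniformTruncatedChord :
    ∀ v : ℝ → ℝ≥0∞, IsRepulsiveFiniteRange v → ∃ ρ₀ : ℝ, 0 < ρ₀ ∧ ∀ ρ : ℝ, 0 < ρ → ρ < ρ₀ →
      ∃ η : ℝ, 0 < η ∧ ∀ᶠ n : ℕ in atTop, ∃ δ : ℝ≥0∞, 0 < δ ∧ ∀ᶠ m : ℕ in atTop,
        ∀ Φ Θ : Config2 n → ℂ,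
          Adm0 n (sideLength ρ (n + 1)) Φ →
          E2zero (truncPotential v m) n (sideLength ρ (n + 1)) Φ ≤
            (⨅ (Θ' : Config2 n → ℂ) (_ : Adm0 n (sideLength ρ (n + 1)) Θ'),
              E2zero (truncPotential v m) n (sideLength ρ (n + 1)) Θ') + δ →
          Adm0 n (sideLength ρ (n + 1)) Θ →
          E2half (truncPotential v m) n (sideLength ρ (n + 1)) Θ ≤
            (⨅ (Θ' : Config2 n → ℂ) (_ : Adm0 n (sideLength ρ (n + 1)) Θ'),
              E2half (truncPotential v m) n (sideLength ρ (n + 1)) Θ') + δ →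
          ENNReal.ofReal (1 / 2 + η) ≤
            (‖∫ Z in cell2 n (sideLength ρ (n + 1)), (starRingEnd ℂ) (Θ Z) * Φ Z‖₊ : ENNReal) ^ 2 := by
  sorry

/-- **Stub X (L): a finite-energy function vanishes a.e. on the pair-profile hard configurations (twin of `ae_eq_zero_of_mem_hardLayer_zero`).** -/
theorem stub_hardLayerPVanishing :
    ∀ (N : ℕ) (L : ℝ), 0 < L → ∀ V : Fin N → Fin N → ℝ → ℝ≥0∞, (∀ i j, V i j = V j i) →
      (∀ i j, Measurable (V i j)) →
      ∀ (η : UnitAddTorus (Fin N × Fin 3) → ℂ) (G H : Fin N × Fin 3 → UnitAddTorus (Fin N × Fin 3) → ℂ),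
        (∀ q, G q =ᵐ[volume] η) →
        (∀ q : Fin N × Fin 3, ∀ᵐ t ∂(volume : Measure (UnitAddTorus (Fin N × Fin 3))),
        (∀ a b : ℝ, IntervalIntegrable (fun x : ℝ => H q (t + Pi.single q ((x : ℝ) : UnitAddCircle))) volume a b ∧
          G q (t + Pi.single q ((b : ℝ) : UnitAddCircle)) - G q (t + Pi.single q ((a : ℝ) : UnitAddCircle)) =
            ∫ x in a..b, H q (t + Pi.single q ((x : ℝ) : UnitAddCircle))) ∧
        (∀ a b : ℝ, ∫⁻ x in Set.Ioo a b, pairInteraction V L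
          (fromUnitTorusN L (t + Pi.single q ((x : ℝ) : UnitAddCircle))) *
            ‖G q (t + Pi.single q ((x : ℝ) : UnitAddCircle))‖ₑ ^ 2 ≠ ⊤)) →
        ∀ᵐ t ∂(volume : Measure (UnitAddTorus (Fin N × Fin 3))), fromUnitTorusN L t ∈ hardLayerP V L 0 → η t = 0 := by
  sorry

/-- **Stub K (M): smooth periodic cut-offs vanishing near the pair-profile hard configurations (twin of `exists_hardLayer_cutoff`, no symmetrisation).** -/
theorem stub_hardLayerPCutoff :
    ∀ (N : ℕ) (L : ℝ), 0 < L → ∀ V : Fin N → Fin N → ℝ → ℝ≥0∞,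
      ∃ C : ℝ, 0 ≤ C ∧ ∀ s : ℝ, 0 < s → s ≤ L →
        ∃ ξ : Config N → ℝ, ContDiff ℝ 1 ξ ∧ IsTorusPeriodic L ξ ∧ (∀ X, 0 ≤ ξ X ∧ ξ X ≤ 1) ∧
          (∀ X ∈ hardLayerP V L (s / 2), ξ X = 0) ∧
          (∀ X ∉ hardLayerP V L s, ∀ X' : Config N, (∀ i, ‖X' i - X i‖ < s / 10) → ξ X' = 1) ∧
          ∀ X, ‖fderiv ℝ ξ X‖ ≤ C / s := by
  sorry

/-- **Stub S (L; dictionary D and cut-off K as hypotheses): the cut-off step for pair profiles (twin of `periodicGroundStateEnergy_mul_le_maxForm_step`).** -/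
theorem stub_pairStep :
    (∀ (N : ℕ) (L : ℝ), 0 < L → ∀ Ψ : Config N → ℂ, ContDiff ℝ 1 Ψ → IsTorusPeriodic L Ψ →
      ∃ ηΨ : Lp ℂ 2 (volume : Measure (UnitAddTorus (Fin N × Fin 3))),
        (∀ᵐ t ∂(volume : Measure (UnitAddTorus (Fin N × Fin 3))),
          (ηΨ : UnitAddTorus (Fin N × Fin 3) → ℂ) t = (cellScale N L : ℂ) * Ψ (fromUnitTorusN L t)) ∧
        ENNReal.ofReal (‖ηΨ‖ ^ 2) = ∫⁻ X in cellN N L, (‖Ψ X‖₊ : ℝ≥0∞) ^ 2 ∧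
        maxFormKin L ηΨ = ∫⁻ X in cellN N L, kineticDensity Ψ X ∧
        ∀ W : Config N → ℝ≥0∞, Measurable W →
          maxFormPotW W L ηΨ = ∫⁻ X in cellN N L, W X * (‖Ψ X‖₊ : ℝ≥0∞) ^ 2) →
    (∀ (N : ℕ) (L : ℝ), 0 < L → ∀ V : Fin N → Fin N → ℝ → ℝ≥0∞,
      ∃ C : ℝ, 0 ≤ C ∧ ∀ s : ℝ, 0 < s → s ≤ L →
        ∃ ξ : Config N → ℝ, ContDiff ℝ 1 ξ ∧ IsTorusPeriodic L ξ ∧ (∀ X, 0 ≤ ξ X ∧ ξ X ≤ 1) ∧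
          (∀ X ∈ hardLayerP V L (s / 2), ξ X = 0) ∧
          (∀ X ∉ hardLayerP V L s, ∀ X' : Config N, (∀ i, ‖X' i - X i‖ < s / 10) → ξ X' = 1) ∧
          ∀ X, ‖fderiv ℝ ξ X‖ ≤ C / s) →
    ∀ (N : ℕ) (L : ℝ), 0 < L → ∀ V : Fin N → Fin N → ℝ → ℝ≥0∞, (∀ i j, V i j = V j i) →
      (∀ i j, IsRepulsiveFiniteRange (V i j)) →
      ∀ (ζ : Lp ℂ 2 (volume : Measure (UnitAddTorus (Fin N × Fin 3)))) (k : ℝ),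
        (∀ᵐ t ∂(volume : Measure (UnitAddTorus (Fin N × Fin 3))), ‖(ζ : UnitAddTorus (Fin N × Fin 3) → ℂ) t‖ ≤ k) →
        (∀ ε' : ℝ, 0 < ε' → ∃ s₀ : ℝ, 0 < s₀ ∧ ∀ s : ℝ, 0 < s → s ≤ s₀ →
          ∫⁻ t in fromUnitTorusN L ⁻¹' hardLayerP V L s,
            ((‖(ζ : UnitAddTorus (Fin N × Fin 3) → ℂ) t‖₊ : ℝ≥0∞)) ^ 2 ≤ ENNReal.ofReal (ε' * s ^ 2)) →
        ∀ ε : ℝ, 0 < ε →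
          absGroundStateEnergyW (pairInteraction V L) L * ENNReal.ofReal (‖ζ‖ ^ 2 - ε) ≤
            ENNReal.ofReal (1 + ε) * maxFormW (pairInteraction V L) L ζ + ENNReal.ofReal ε := by
  sorry

/-- **Stub Y (L): the integrated Hardy layer bound for pair profiles (twin of `setLIntegral_layerA_le`).** -/
theorem stub_hardLayerPHardy :
    ∀ (N : ℕ) (L : ℝ), 0 < L → ∀ V : Fin N → Fin N → ℝ → ℝ≥0∞, (∀ i j, V i j = V j i) →
      (∀ i j, Measurable (V i j)) →
      ∀ (η : UnitAddTorus (Fin N × Fin 3) → ℂ) (G H : Fin N × Fin 3 → UnitAddTorus (Fin N × Fin 3) → ℂ),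
        (∀ q, G q =ᵐ[volume] η) → (∀ q, Measurable (H q)) →
        (∀ q : Fin N × Fin 3, ∀ᵐ t ∂(volume : Measure (UnitAddTorus (Fin N × Fin 3))),
        (∀ a b : ℝ, IntervalIntegrable (fun x : ℝ => H q (t + Pi.single q ((x : ℝ) : UnitAddCircle))) volume a b ∧
          G q (t + Pi.single q ((b : ℝ) : UnitAddCircle)) - G q (t + Pi.single q ((a : ℝ) : UnitAddCircle)) =
            ∫ x in a..b, H q (t + Pi.single q ((x : ℝ) : UnitAddCircle))) ∧
        (∀ a b : ℝ, ∫⁻ x in Set.Ioo a b, pairInteraction V L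
          (fromUnitTorusN L (t + Pi.single q ((x : ℝ) : UnitAddCircle))) *
            ‖G q (t + Pi.single q ((x : ℝ) : UnitAddCircle))‖ₑ ^ 2 ≠ ⊤)) →
        ∀ s : ℝ, 0 < s →
          ∫⁻ t in {t : UnitAddTorus (Fin N × Fin 3) | ∃ (i j : Fin N) (n : Fin 3 → ℤ), i ≠ j ∧
              (hardRad (V i j)).Nonempty ∧
              0 < Metric.infDist (pairRad L (fromUnitTorusN L t) i j n) (hardRad (V i j)) ∧
              Metric.infDist (pairRad L (fromUnitTorusN L t) i j n) (hardRad (V i j)) ≤ 3 * s ∧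
              40 * s ≤ pairRad L (fromUnitTorusN L t) i j n},
            ‖η t‖ₑ ^ 2 ≤
            ENNReal.ofReal (11 * s / L) * ENNReal.ofReal (22 * s / L) *
              ∑ q : Fin N × Fin 3, ∫⁻ t, (hardZoneP V L s).indicator (1 : Config N → ℝ≥0∞) (fromUnitTorusN L t) *
                ‖H q t‖ₑ ^ 2 := by
  sorry

/-- **Stub Z (L; Y and X as hypotheses): the mass in the pair-profile hard layers is `o(s²)` (twin of `exists_setLIntegral_hardLayer_le`).** -/
theorem stub_hardLayerPDecay :
    (∀ (N : ℕ) (L : ℝ), 0 < L → ∀ V : Fin N → Fin N → ℝ → ℝ≥0∞, (∀ i j, V i j = V j i) →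
      (∀ i j, Measurable (V i j)) →
      ∀ (η : UnitAddTorus (Fin N × Fin 3) → ℂ) (G H : Fin N × Fin 3 → UnitAddTorus (Fin N × Fin 3) → ℂ),
        (∀ q, G q =ᵐ[volume] η) → (∀ q, Measurable (H q)) →
        (∀ q : Fin N × Fin 3, ∀ᵐ t ∂(volume : Measure (UnitAddTorus (Fin N × Fin 3))),
        (∀ a b : ℝ, IntervalIntegrable (fun x : ℝ => H q (t + Pi.single q ((x : ℝ) : UnitAddCircle))) volume a b ∧
          G q (t + Pi.single q ((b : ℝ) : UnitAddCircle)) - G q (t + Pi.single q ((a : ℝ) : UnitAddCircle)) =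
            ∫ x in a..b, H q (t + Pi.single q ((x : ℝ) : UnitAddCircle))) ∧
        (∀ a b : ℝ, ∫⁻ x in Set.Ioo a b, pairInteraction V L
          (fromUnitTorusN L (t + Pi.single q ((x : ℝ) : UnitAddCircle))) *
            ‖G q (t + Pi.single q ((x : ℝ) : UnitAddCircle))‖ₑ ^ 2 ≠ ⊤)) →
        ∀ s : ℝ, 0 < s →
          ∫⁻ t in {t : UnitAddTorus (Fin N × Fin 3) | ∃ (i j : Fin N) (n : Fin 3 → ℤ), i ≠ j ∧
              (hardRad (V i j)).Nonempty ∧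
              0 < Metric.infDist (pairRad L (fromUnitTorusN L t) i j n) (hardRad (V i j)) ∧
              Metric.infDist (pairRad L (fromUnitTorusN L t) i j n) (hardRad (V i j)) ≤ 3 * s ∧
              40 * s ≤ pairRad L (fromUnitTorusN L t) i j n},
            ‖η t‖ₑ ^ 2 ≤
            ENNReal.ofReal (11 * s / L) * ENNReal.ofReal (22 * s / L) *
              ∑ q : Fin N × Fin 3, ∫⁻ t, (hardZoneP V L s).indicator (1 : Config N → ℝ≥0∞) (fromUnitTorusN L t) *
                ‖H q t‖ₑ ^ 2) →
    (∀ (N : ℕ) (L : ℝ), 0 < L → ∀ V : Fin N → Fin N → ℝ → ℝ≥0∞, (∀ i j, V i j = V j i) →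
      (∀ i j, Measurable (V i j)) →
      ∀ (η : UnitAddTorus (Fin N × Fin 3) → ℂ) (G H : Fin N × Fin 3 → UnitAddTorus (Fin N × Fin 3) → ℂ),
        (∀ q, G q =ᵐ[volume] η) →
        (∀ q : Fin N × Fin 3, ∀ᵐ t ∂(volume : Measure (UnitAddTorus (Fin N × Fin 3))),
        (∀ a b : ℝ, IntervalIntegrable (fun x : ℝ => H q (t + Pi.single q ((x : ℝ) : UnitAddCircle))) volume a b ∧
          G q (t + Pi.single q ((b : ℝ) : UnitAddCircle)) - G q (t + Pi.single q ((a : ℝ) : UnitAddCircle)) =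
            ∫ x in a..b, H q (t + Pi.single q ((x : ℝ) : UnitAddCircle))) ∧
        (∀ a b : ℝ, ∫⁻ x in Set.Ioo a b, pairInteraction V L
          (fromUnitTorusN L (t + Pi.single q ((x : ℝ) : UnitAddCircle))) *
            ‖G q (t + Pi.single q ((x : ℝ) : UnitAddCircle))‖ₑ ^ 2 ≠ ⊤)) →
        ∀ᵐ t ∂(volume : Measure (UnitAddTorus (Fin N × Fin 3))), fromUnitTorusN L t ∈ hardLayerP V L 0 → η t = 0) →
    ∀ (N : ℕ) (L : ℝ), 0 < L → ∀ V : Fin N → Fin N → ℝ → ℝ≥0∞, (∀ i j, V i j = V j i) →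
      (∀ i j, Measurable (V i j)) → ∀ R₀ : ℝ, (∀ i j, ∀ b ∈ hardRad (V i j), b ≤ R₀) →
      ∀ (η : UnitAddTorus (Fin N × Fin 3) → ℂ) (G H : Fin N × Fin 3 → UnitAddTorus (Fin N × Fin 3) → ℂ),
        (∀ q, G q =ᵐ[volume] η) → (∀ q, Measurable (H q)) → (∀ q, ∫⁻ t, ‖H q t‖ₑ ^ 2 ≠ ⊤) →
        (∀ q : Fin N × Fin 3, ∀ᵐ t ∂(volume : Measure (UnitAddTorus (Fin N × Fin 3))),
        (∀ a b : ℝ, IntervalIntegrable (fun x : ℝ => H q (t + Pi.single q ((x : ℝ) : UnitAddCircle))) volume a b ∧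
          G q (t + Pi.single q ((b : ℝ) : UnitAddCircle)) - G q (t + Pi.single q ((a : ℝ) : UnitAddCircle)) =
            ∫ x in a..b, H q (t + Pi.single q ((x : ℝ) : UnitAddCircle))) ∧
        (∀ a b : ℝ, ∫⁻ x in Set.Ioo a b, pairInteraction V L
          (fromUnitTorusN L (t + Pi.single q ((x : ℝ) : UnitAddCircle))) *
            ‖G q (t + Pi.single q ((x : ℝ) : UnitAddCircle))‖ₑ ^ 2 ≠ ⊤)) →
        ∀ k : ℝ, (∀ᵐ t ∂(volume : Measure (UnitAddTorus (Fin N × Fin 3))), ‖η t‖ ≤ k) →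
        ∀ ε : ℝ, 0 < ε → ∃ s₀ : ℝ, 0 < s₀ ∧ ∀ s : ℝ, 0 < s → s ≤ s₀ →
          ∫⁻ t in fromUnitTorusN L ⁻¹' hardLayerP V L s, ‖η t‖ₑ ^ 2 ≤ ENNReal.ofReal (ε * s ^ 2) := by
  sorry

/-- **Stub F (L; Z and S as hypotheses): clamping + ACL representatives + the `ε → 0` step (twin of `PeriodicMaxFormBoundHardCore.lean`).** -/
theorem stub_pairFinal :
    (∀ (N : ℕ) (L : ℝ), 0 < L → ∀ V : Fin N → Fin N → ℝ → ℝ≥0∞, (∀ i j, V i j = V j i) →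
      (∀ i j, Measurable (V i j)) → ∀ R₀ : ℝ, (∀ i j, ∀ b ∈ hardRad (V i j), b ≤ R₀) →
      ∀ (η : UnitAddTorus (Fin N × Fin 3) → ℂ) (G H : Fin N × Fin 3 → UnitAddTorus (Fin N × Fin 3) → ℂ),
        (∀ q, G q =ᵐ[volume] η) → (∀ q, Measurable (H q)) → (∀ q, ∫⁻ t, ‖H q t‖ₑ ^ 2 ≠ ⊤) →
        (∀ q : Fin N × Fin 3, ∀ᵐ t ∂(volume : Measure (UnitAddTorus (Fin N × Fin 3))),
        (∀ a b : ℝ, IntervalIntegrable (fun x : ℝ => H q (t + Pi.single q ((x : ℝ) : UnitAddCircle))) volume a b ∧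
          G q (t + Pi.single q ((b : ℝ) : UnitAddCircle)) - G q (t + Pi.single q ((a : ℝ) : UnitAddCircle)) =
            ∫ x in a..b, H q (t + Pi.single q ((x : ℝ) : UnitAddCircle))) ∧
        (∀ a b : ℝ, ∫⁻ x in Set.Ioo a b, pairInteraction V L
          (fromUnitTorusN L (t + Pi.single q ((x : ℝ) : UnitAddCircle))) *
            ‖G q (t + Pi.single q ((x : ℝ) : UnitAddCircle))‖ₑ ^ 2 ≠ ⊤)) →
        ∀ k : ℝ, (∀ᵐ t ∂(volume : Measure (UnitAddTorus (Fin N × Fin 3))), ‖η t‖ ≤ k) →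
        ∀ ε : ℝ, 0 < ε → ∃ s₀ : ℝ, 0 < s₀ ∧ ∀ s : ℝ, 0 < s → s ≤ s₀ →
          ∫⁻ t in fromUnitTorusN L ⁻¹' hardLayerP V L s, ‖η t‖ₑ ^ 2 ≤ ENNReal.ofReal (ε * s ^ 2)) →
    (∀ (N : ℕ) (L : ℝ), 0 < L → ∀ V : Fin N → Fin N → ℝ → ℝ≥0∞, (∀ i j, V i j = V j i) →
      (∀ i j, IsRepulsiveFiniteRange (V i j)) →
      ∀ (ζ : Lp ℂ 2 (volume : Measure (UnitAddTorus (Fin N × Fin 3)))) (k : ℝ),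
        (∀ᵐ t ∂(volume : Measure (UnitAddTorus (Fin N × Fin 3))), ‖(ζ : UnitAddTorus (Fin N × Fin 3) → ℂ) t‖ ≤ k) →
        (∀ ε' : ℝ, 0 < ε' → ∃ s₀ : ℝ, 0 < s₀ ∧ ∀ s : ℝ, 0 < s → s ≤ s₀ →
          ∫⁻ t in fromUnitTorusN L ⁻¹' hardLayerP V L s,
            ((‖(ζ : UnitAddTorus (Fin N × Fin 3) → ℂ) t‖₊ : ℝ≥0∞)) ^ 2 ≤ ENNReal.ofReal (ε' * s ^ 2)) →
        ∀ ε : ℝ, 0 < ε →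
          absGroundStateEnergyW (pairInteraction V L) L * ENNReal.ofReal (‖ζ‖ ^ 2 - ε) ≤
            ENNReal.ofReal (1 + ε) * maxFormW (pairInteraction V L) L ζ + ENNReal.ofReal ε) →
    ∀ (N : ℕ) (L : ℝ), 0 < L → ∀ V : Fin N → Fin N → ℝ → ℝ≥0∞, (∀ i j, V i j = V j i) →
      (∀ i j, IsRepulsiveFiniteRange (V i j)) →
      ∀ η : Lp ℂ 2 (volume : Measure (UnitAddTorus (Fin N × Fin 3))),
        absGroundStateEnergyW (pairInteraction V L) L * ENNReal.ofReal (‖η‖ ^ 2) ≤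
          maxFormW (pairInteraction V L) L η := by
  sorry

/-- **H from X, K, S, Y, Z, F (sorry-free): the pair-profile hard-core maximal-form bound on the absolute class**
(`Goal.stub_absMaxFormBoundPair`; the `L¹` bound B is not needed — the cut-off step approximates in the softened
`L¹` weight directly). [cite: ReedSimonIV1978, Thm. XIII.64] -/
theorem absMaxFormBoundPair_of (hX : Goal.stub_hardLayerPVanishing) (hK : Goal.stub_hardLayerPCutoff)
    (hS : Goal.stub_pairStep) (hY : Goal.stub_hardLayerPHardy) (hZ : Goal.stub_hardLayerPDecay)
    (hF : Goal.stub_pairFinal) : Goal.stub_absMaxFormBoundPair :=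
  fun hD _hB => hF (hZ hY hX) (hS hD hK)

/-! ## Composition (sorry-free): T, R, C, B, H ⇒ S; U, S ⇒ the crux by name -/

/-- Monotonicity of the truncations in the height (pointwise). [folklore] -/
theorem truncPotential_mono_height (v : ℝ → ℝ≥0∞) {m m' : ℕ} (h : m ≤ m') (r : ℝ) :
    truncPotential v m r ≤ truncPotential v m' r :=
  monotone_truncPotential v r h

/-- The half-swapped weights of the truncations increase with the truncation height. [folklore] -/
theorem monotone_halfSwapWeight_truncPotential (v : ℝ → ℝ≥0∞) (n : ℕ) (L : ℝ) (Z : Config2 n) :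
    Monotone fun m : ℕ => halfSwapWeight (truncPotential v m) n L Z :=
  fun _ _ h => Split.halfSwapWeight_mono_of_le (truncPotential_mono_height v h) n L Z

/-- `⨆ₘ w_½(v ⊓ m) = w_½(v)` pointwise: the half-swapped weight of `v` is the monotone limit of those of its
truncations. [folklore] -/
theorem iSup_halfSwapWeight_truncPotential (v : ℝ → ℝ≥0∞) (n : ℕ) (L : ℝ) (Z : Config2 n) :
    ⨆ m : ℕ, halfSwapWeight (truncPotential v m) n L Z = halfSwapWeight v n L Z := by
  have hP : ∀ x : Space, Monotone fun m : ℕ => periodizedPotential (truncPotential v m) L x :=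
    fun x => monotone_periodizedPotential_truncPotential v L x
  have hI : ∀ {k : ℕ} (X : Config k), Monotone fun m : ℕ => periodicInteraction (truncPotential v m) L X :=
    fun X => monotone_periodicInteraction_truncPotential v L X
  -- the four-term sums and the `j`-sum are monotone
  have h4 : ∀ j : Fin n, Monotone fun m : ℕ =>
      periodizedPotential (truncPotential v m) L (Z.1 0 - Z.1 j.succ) +
        periodizedPotential (truncPotential v m) L (Z.2 0 - Z.2 j.succ) +
        periodizedPotential (truncPotential v m) L (Z.2 0 - Z.1 j.succ) +
        periodizedPotential (truncPotential v m) L (Z.1 0 - Z.2 j.succ) :=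
    fun j => (((hP _).add (hP _)).add (hP _)).add (hP _)
  have hS : ∀ j : Fin n, Monotone fun m : ℕ => (2 : ℝ≥0∞)⁻¹ *
      (periodizedPotential (truncPotential v m) L (Z.1 0 - Z.1 j.succ) +
        periodizedPotential (truncPotential v m) L (Z.2 0 - Z.2 j.succ) +
        periodizedPotential (truncPotential v m) L (Z.2 0 - Z.1 j.succ) +
        periodizedPotential (truncPotential v m) L (Z.1 0 - Z.2 j.succ)) :=
    fun j => (h4 j).const_mul' _
  have hsum : Monotone fun m : ℕ => ∑ j : Fin n, (2 : ℝ≥0∞)⁻¹ *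
      (periodizedPotential (truncPotential v m) L (Z.1 0 - Z.1 j.succ) +
        periodizedPotential (truncPotential v m) L (Z.2 0 - Z.2 j.succ) +
        periodizedPotential (truncPotential v m) L (Z.2 0 - Z.1 j.succ) +
        periodizedPotential (truncPotential v m) L (Z.1 0 - Z.2 j.succ)) :=
    fun _ _ h => Finset.sum_le_sum fun j _ => hS j h
  unfold halfSwapWeight
  rw [← ENNReal.iSup_add_iSup_of_monotone ((hI _).add (hI _)) hsum,
    ← ENNReal.iSup_add_iSup_of_monotone (hI _) (hI _), iSup_periodicInteraction_truncPotential,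
    iSup_periodicInteraction_truncPotential, ← ENNReal.finsetSum_iSup_of_monotone hS]
  congr 1
  refine Finset.sum_congr rfl fun j _ => ?_
  rw [← ENNReal.mul_iSup]
  congr 1
  rw [← ENNReal.iSup_add_iSup_of_monotone (((hP _).add (hP _)).add (hP _)) (hP _),
    ← ENNReal.iSup_add_iSup_of_monotone ((hP _).add (hP _)) (hP _),
    ← ENNReal.iSup_add_iSup_of_monotone (hP _) (hP _)]
  simp only [iSup_periodizedPotential_truncPotential]

/-- **S from T, R, C, B, H (sorry-free): half-swap truncation stability** — two-copy Simon monotone convergence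
for the half-swapped form on the absolute class. [cite: ReedSimonIV1978, Thm. XIII.64] -/
theorem halfSwapTruncationStability_of (hT : Goal.stub_twoCopyTransport) (hD : Goal.stub_absTransportDict)
    (hR : Goal.stub_scalarRellich) (hC : Goal.stub_absLimitProfile) (hB : Goal.stub_absMaxFormBoundL1)
    (hH : Goal.stub_absMaxFormBoundPair) : Goal.stub_halfSwapTruncationStability := by
  intro v hv n L hL hfin ε hε
  -- transported weights on `Config ((n+1)+(n+1))`
  set Wm : ℕ → Config ((n + 1) + (n + 1)) → ℝ≥0∞ :=
    fun m Z => halfSwapWeight (truncPotential v m) n L (splitConfig (n + 1) (n + 1) Z) with hWm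
  set W : Config ((n + 1) + (n + 1)) → ℝ≥0∞ :=
    fun Z => halfSwapWeight v n L (splitConfig (n + 1) (n + 1) Z) with hW
  have hTm : ∀ m, (⨅ (Θ : Config2 n → ℂ) (_ : Adm0 n L Θ), E2half (truncPotential v m) n L Θ) =
      absGroundStateEnergyW (Wm m) L := fun m => (hT (truncPotential v m) n L hL).1
  have hTv : (⨅ (Θ : Config2 n → ℂ) (_ : Adm0 n L Θ), E2half v n L Θ) = absGroundStateEnergyW W L :=
    (hT v n L hL).1
  have hWpair : W = pairInteraction (halfSwapProfile v n) L := funext (hT v n L hL).2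
  -- the tower is measurable and monotone with pointwise supremum `W`
  have hmeas : ∀ m, Measurable (Wm m) := fun m =>
    (HalfSwapForm.measurable_halfSwapWeight (measurable_truncPotential hv.1 m) n L).comp
      (splitConfig (n + 1) (n + 1)).measurable
  have hmono : ∀ Z, Monotone fun m => Wm m Z := fun Z =>
    monotone_halfSwapWeight_truncPotential v n L _
  have hsup : ∀ Z, ⨆ m, Wm m Z = W Z := fun Z => iSup_halfSwapWeight_truncPotential v n L _
  -- finiteness of the supremum of the truncated energies
  have hsup_le : (⨆ m, absGroundStateEnergyW (Wm m) L) ≤ absGroundStateEnergyW W L :=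
    iSup_le fun m => absGroundStateEnergyW_mono (fun Z => (hsup Z) ▸ le_iSup (fun m => Wm m Z) m) L
  have hfinA : absGroundStateEnergyW W L ≠ ⊤ := hTv ▸ hfin
  have hsup_ne : (⨆ m, absGroundStateEnergyW (Wm m) L) ≠ ⊤ := ne_top_of_le_ne_top hfinA hsup_le
  -- the limit profile and the maximal-form bound at it
  obtain ⟨η, hη1, hηE⟩ := hC hD hR ((n + 1) + (n + 1)) L hL Wm W hmeas hmono hsup hsup_ne
  have hHB := hH hD hB ((n + 1) + (n + 1)) L hL (halfSwapProfile v n) (halfSwapProfile_comm v n)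
    (isRepulsiveFiniteRange_halfSwapProfile hv n) η
  rw [← hWpair, hη1, one_pow, ENNReal.ofReal_one, mul_one] at hHB
  have hkey : absGroundStateEnergyW W L ≤ ⨆ m, absGroundStateEnergyW (Wm m) L := hHB.trans hηE
  -- `E₀ᴬ(W_m) ↑ ⨆ₘ E₀ᴬ(W_m)` in `ℝ≥0∞`
  have hEmono : Monotone fun m => absGroundStateEnergyW (Wm m) L := fun m m' h =>
    absGroundStateEnergyW_mono (fun Z => hmono Z h) L
  have htend : Tendsto (fun m => absGroundStateEnergyW (Wm m) L) atTop
      (𝓝 (⨆ m, absGroundStateEnergyW (Wm m) L)) := tendsto_atTop_iSup hEmono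
  obtain ⟨m₀, hm₀⟩ := (ENNReal.tendsto_atTop hsup_ne).1 htend (ENNReal.ofReal ε) (ENNReal.ofReal_pos.2 hε)
  refine ⟨m₀, fun m hm => ?_⟩
  rw [hTv, hTm m]
  exact hkey.trans (tsub_le_iff_right.1 (hm₀ m hm).1)

/-- Read-back: the proved S is literally the registered statement of `stub_halfSwapTruncationStability`. -/
theorem stub_halfSwapTruncationStability_iff :
    Goal.stub_halfSwapTruncationStability ↔
    (∀ v : ℝ → ℝ≥0∞, IsRepulsiveFiniteRange v → ∀ (n : ℕ) (L : ℝ), 0 < L →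
      (⨅ (Θ : Config2 n → ℂ) (_ : Adm0 n L Θ), E2half v n L Θ) ≠ ⊤ → ∀ ε : ℝ, 0 < ε →
        ∃ m₀ : ℕ, ∀ m : ℕ, m₀ ≤ m → (⨅ (Θ : Config2 n → ℂ) (_ : Adm0 n L Θ), E2half v n L Θ) ≤
          (⨅ (Θ : Config2 n → ℂ) (_ : Adm0 n L Θ), E2half (truncPotential v m) n L Θ) + ENNReal.ofReal ε) :=
  Iff.rfl

/-- **Composition (kernel-checked, no sorry of its own): U, T, R, C, B, H ⇒ the crux BY NAME**, via the landed
truncation-split glue `Split.TorusHalfSwapOverlap_of_subs_folded` fed with `halfSwapTruncationStability_of`. -/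
theorem TorusHalfSwapOverlap_of (hU : Goal.stub_uniformTruncatedChord) (hT : Goal.stub_twoCopyTransport)
    (hD : Goal.stub_absTransportDict) (hR : Goal.stub_scalarRellich) (hC : Goal.stub_absLimitProfile)
    (hB : Goal.stub_absMaxFormBoundL1) (hH : Goal.stub_absMaxFormBoundPair) :
    Summit.AtomisticToContinuum.BoseEinsteinCondensation.Theses.BECSwapNoCatastrophe.TorusHalfSwapOverlap :=
  Split.TorusHalfSwapOverlap_of_subs_folded hU (halfSwapTruncationStability_of hT hD hR hC hB hH)

/-- The same, closed with the sorried stubs of this file (so the audit sees the crux concluded by name). -/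
theorem TorusHalfSwapOverlap_holds_modulo_stubs :
    Summit.AtomisticToContinuum.BoseEinsteinCondensation.Theses.BECSwapNoCatastrophe.TorusHalfSwapOverlap :=
  TorusHalfSwapOverlap_of stub_uniformTruncatedChord stub_twoCopyTransport stub_absTransportDict stub_scalarRellich
    stub_absLimitProfile stub_absMaxFormBoundL1
    (absMaxFormBoundPair_of stub_hardLayerPVanishing stub_hardLayerPCutoff stub_pairStep stub_hardLayerPHardy
      stub_hardLayerPDecay stub_pairFinal)

end Summit.AtomisticToContinuum.BoseEinsteinCondensation.Cruxes.TorusHalfSwapOverlap.TruncationSplit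

end
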